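import Mathlib
import HarnessLib
import Summits.Ventures.LatticeQCDFlow.Exactness.NCMCGeneralSpaceReplicaPooledMeanCentringCoverage

/-!
# The printed error bar of Wolff's replica-pooled Γ-method (pooled-mean centring) is asymptotically exact: `P{ |m̄_{R,n} − πf| ≤ z √(V̂ᵂ_{R,n}/(R n)) } → N(0,1)([−z, z])` from EVERY family of initial laws

HONEST FRAMING: exact (Metropolis-corrected) sampling algorithms for lattice gauge theory;
figures of merit are autocorrelation/cost numbers at stated couplings and volumes; no
continuum-physics claim.

Venture `LatticeQCDFlow` (cell pub-lqcd), topic `Exactness`; FANOUT row 13 (`eng-snf`, GEN-23).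
NEW WORK of the cell, not a published result; no definition is introduced; nothing is cited as a
fact (U. Wolff, Comput. Phys. Commun. 156 (2004) 143, §3.3 — NAMED ONLY).  The interval form of
`NCMCGeneralSpaceReplicaPooledMeanCentringCoverage`: with `R` independent replicas of a chain with a
Doeblin power started anywhere, the pooled mean `m̄_{R,n}`, and Wolff's windowed autocovariance sum
`V̂ᵂ_{R,n}` (fluctuations about `m̄`, normalisation `1/(R(n − t))`, common window `W_n → ∞`,
`W_n³/n → 0`), the interval `m̄_{R,n} ± z √(V̂ᵂ_{R,n}/(R n))` contains `πf` with probability tending to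
`gaussianReal 0 1 (Icc (−z) z)` — because `V̂ᵂ_{R,n} → σ²_f > 0` in probability (previous file) and the
pooled sum is asymptotically `N(0, σ²_f)` at the pooled sample size (GEN-23
`NCMCGeneralSpaceReplicaPooledCLT`), by GEN-20's plug-in coverage lemma and interval algebra exactly as
for the replica-mean centring (`NCMCGeneralSpaceReplicaPooledGammaCoverage`).

## Content

* `measurable_pooledCentredWindow`;
* **`tendsto_measure_studentized_pooledSum_le_wolff_of_nHit`** —
  `P{ |(√(R n))⁻¹ Σ_r Σ_{t<n} (f(x^r_t) − πf) · (√V̂ᵂ_{R,n})⁻¹| ≤ z } → gaussianReal 0 1 (Icc (−z) z)`;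
* **`tendsto_measure_pooledMean_mem_wolffInterval_of_nHit`** — THE PRINTED FORM:
  `P{ |m̄_{R,n} − πf| ≤ z √(V̂ᵂ_{R,n}/(R n)) } → gaussianReal 0 1 (Icc (−z) z)`.

NOT CLAIMED: Wolff's bias-correction factor `1 + (2W+1)/N` (it tends to `1` and does not change the
limit, but is not typed); his automatic window; unequal replica lengths; anything numerical.
-/

namespace Summit.Ventures.LatticeQCDFlow.Exactness.GeneralNCMC

open MeasureTheory ProbabilityTheory Set Filter Finset
open scoped ENNReal NNReal Topology

variable {S : Type*} [MeasurableSpace S]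

section Pooled

variable {κ : Kernel S S} [IsMarkovKernel κ] {π : Measure S} [IsProbabilityMeasure π]
  {ν : Measure S} [IsProbabilityMeasure ν] {ε : ℝ≥0∞} {m : ℕ}
  {ι : Type*} [Fintype ι] [Nonempty ι]

omit [Nonempty ι] in
/-- Wolff's pooled statistic is a measurable function of the replica paths. -/
theorem measurable_pooledCentredWindow {f : S → ℝ} (hf : Measurable f) (n W : ℕ) :
    Measurable fun x : ι → ℕ → S =>
      (∑ r, (Scoring.lagSum (fun i => f (x r i)
            - (∑ r', ∑ i ∈ range n, f (x r' i)) / ((Fintype.card ι : ℝ) * n)) n 0 / ((n - 0 : ℕ) : ℝ)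
        + 2 * ∑ t ∈ range W, Scoring.lagSum (fun i => f (x r i)
            - (∑ r', ∑ i ∈ range n, f (x r' i)) / ((Fintype.card ι : ℝ) * n)) n (t + 1)
              / ((n - (t + 1) : ℕ) : ℝ))) / Fintype.card ι := by
  have hfx : ∀ (r : ι) (i : ℕ), Measurable fun x : ι → ℕ → S => f (x r i) := fun r i =>
    hf.comp ((measurable_pi_apply i).comp (measurable_pi_apply r))
  have hm : Measurable fun x : ι → ℕ → S =>
      (∑ r', ∑ i ∈ range n, f (x r' i)) / ((Fintype.card ι : ℝ) * n) :=
    (Finset.measurable_sum _ fun r _ => Finset.measurable_sum _ fun i _ => hfx r i).div_const _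
  have hlag : ∀ (r : ι) (t : ℕ), Measurable fun x : ι → ℕ → S => Scoring.lagSum (fun i => f (x r i)
      - (∑ r', ∑ i ∈ range n, f (x r' i)) / ((Fintype.card ι : ℝ) * n)) n t := by
    intro r t
    simp only [Scoring.lagSum]
    exact Finset.measurable_sum _ fun i _ => ((hfx r i).sub hm).mul ((hfx r (i + t)).sub hm)
  refine (Finset.measurable_sum _ fun r _ => ((hlag r 0).div_const _).add ?_).div_const _
  exact (Finset.measurable_sum _ fun t _ => (hlag r (t + 1)).div_const _).const_mul _

/-- **EXACT ASYMPTOTIC COVERAGE WITH WOLFF'S STATISTIC, EVERY FAMILY OF STARTS.**  `κ` Markov, `π`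
invariant, `(nHit κ m)(z, ·) ≥ ε ν` (`ε ≠ 0`, `0 < m`), `|f| ≤ C` with `σ²_f > 0`; windows `W_n → ∞`,
`W_n³/n → 0`; `z > 0`; `R = card ι` independent replicas from ANY laws `μ r`.  Then
`P{ |(√(R n))⁻¹ Σ_r Σ_{t<n} (f(x^r_t) − πf) · (√V̂ᵂ_{R,n})⁻¹| ≤ z } → gaussianReal 0 1 (Icc (−z) z)`. -/
theorem tendsto_measure_studentized_pooledSum_le_wolff_of_nHit (hπ : Kernel.Invariant κ π)
    (hε : ε ≠ 0) (hmin : ∀ z, ε • ν ≤ nHit κ m z) (hm : 0 < m)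
    {f : S → ℝ} (hf : Measurable f) {C : ℝ} (hC : ∀ x, |f x| ≤ C)
    (hσ : 0 < Scoring.autocov κ π (fun y => f y - ∫ z, f z ∂π) 0
        + 2 * ∑' t, Scoring.autocov κ π (fun y => f y - ∫ z, f z ∂π) (t + 1))
    {W : ℕ → ℕ} (hW : Tendsto W atTop atTop) (hW3 : Tendsto (fun N => (W N : ℝ) ^ 3 / N) atTop (𝓝 0))
    (μ : ι → Measure S) [∀ r, IsProbabilityMeasure (μ r)] {z : ℝ} (hz : 0 < z)
    [∀ r, IsProbabilityMeasure (Kernel.trajMeasure (X := fun _ : ℕ => S) (μ r)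
        (fun n : ℕ => κ.comap (fun hh : (i : ↥(Finset.Iic n)) → S => hh ⟨n, Finset.mem_Iic.2 le_rfl⟩)
          (measurable_pi_apply _)))] :
    Tendsto (fun n : ℕ => (Measure.pi fun r => Kernel.trajMeasure (X := fun _ : ℕ => S) (μ r)
        (fun n : ℕ => κ.comap (fun hh : (i : ↥(Finset.Iic n)) → S => hh ⟨n, Finset.mem_Iic.2 le_rfl⟩)
          (measurable_pi_apply _)))
        {x : ι → ℕ → S | |((Real.sqrt ((Fintype.card ι : ℝ) * n))⁻¹
            * ∑ r, ∑ t ∈ range n, (f (x r t) - ∫ z, f z ∂π))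
          * (Real.sqrt ((∑ r, (Scoring.lagSum (fun i => f (x r i)
              - (∑ r', ∑ i ∈ range n, f (x r' i)) / ((Fintype.card ι : ℝ) * n)) n 0 / ((n - 0 : ℕ) : ℝ)
            + 2 * ∑ t ∈ range (W n), Scoring.lagSum (fun i => f (x r i)
              - (∑ r', ∑ i ∈ range n, f (x r' i)) / ((Fintype.card ι : ℝ) * n)) n (t + 1)
                / ((n - (t + 1) : ℕ) : ℝ))) / Fintype.card ι))⁻¹| ≤ z})
      atTop (𝓝 (gaussianReal 0 1 (Icc (-z) z))) := by
  set σ2 := Scoring.autocov κ π (fun y => f y - ∫ z, f z ∂π) 0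
    + 2 * ∑' t, Scoring.autocov κ π (fun y => f y - ∫ z, f z ∂π) (t + 1) with hσ2
  have hclt := tendstoInDistribution_pooledSum_of_nHit hπ hε hmin hm hf hC μ
    (P' := gaussianReal 0 σ2.toNNReal) (Y := id) HasLaw.id
  have hcons := pooledCentredWindow_tendstoInMeasure_of_nHit hπ hε hmin hm hf hC hW hW3 μ
  have hsq : ContinuousAt (fun v : ℝ => (Real.sqrt v)⁻¹) σ2 :=
    Real.continuous_sqrt.continuousAt.inv₀ (Real.sqrt_pos.2 hσ).ne'
  have hBm := fun n => (measurable_pooledCentredWindow (ι := ι) hf n (W n)).sqrt.inv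
  have hB := tendstoInMeasure_comp_continuousAt (g := fun v : ℝ => (Real.sqrt v)⁻¹) hcons hsq hBm
  have h := tendsto_measure_abs_mul_le_of_clt_of_tendstoInMeasure hBm HasLaw.id hclt hB hz
  have hb2 : NNReal.mk (((Real.sqrt σ2)⁻¹) ^ 2) (sq_nonneg _) * σ2.toNNReal = 1 := by
    apply NNReal.eq
    rw [NNReal.coe_mul, NNReal.coe_mk, Real.coe_toNNReal _ hσ.le, NNReal.coe_one, inv_pow,
      Real.sq_sqrt hσ.le, inv_mul_cancel₀ hσ.ne']
  rw [hb2] at h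
  exact h

/-- **THE PRINTED WOLFF INTERVAL CONTAINS `πf` WITH ASYMPTOTICALLY NOMINAL PROBABILITY, EVERY FAMILY OF
STARTS**: with `m̄_{R,n} = (Σ_r Σ_{t<n} f(x^r_t))/(R n)` and Wolff's `V̂ᵂ_{R,n}`, for every `z > 0`:
`P{ |m̄_{R,n} − πf| ≤ z √(V̂ᵂ_{R,n}/(R n)) } → gaussianReal 0 1 (Icc (−z) z)`. -/
theorem tendsto_measure_pooledMean_mem_wolffInterval_of_nHit (hπ : Kernel.Invariant κ π)
    (hε : ε ≠ 0) (hmin : ∀ z, ε • ν ≤ nHit κ m z) (hm : 0 < m)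
    {f : S → ℝ} (hf : Measurable f) {C : ℝ} (hC : ∀ x, |f x| ≤ C)
    (hσ : 0 < Scoring.autocov κ π (fun y => f y - ∫ z, f z ∂π) 0
        + 2 * ∑' t, Scoring.autocov κ π (fun y => f y - ∫ z, f z ∂π) (t + 1))
    {W : ℕ → ℕ} (hW : Tendsto W atTop atTop) (hW3 : Tendsto (fun N => (W N : ℝ) ^ 3 / N) atTop (𝓝 0))
    (μ : ι → Measure S) [∀ r, IsProbabilityMeasure (μ r)] {z : ℝ} (hz : 0 < z)
    [∀ r, IsProbabilityMeasure (Kernel.trajMeasure (X := fun _ : ℕ => S) (μ r)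
        (fun n : ℕ => κ.comap (fun hh : (i : ↥(Finset.Iic n)) → S => hh ⟨n, Finset.mem_Iic.2 le_rfl⟩)
          (measurable_pi_apply _)))] :
    Tendsto (fun n : ℕ => (Measure.pi fun r => Kernel.trajMeasure (X := fun _ : ℕ => S) (μ r)
        (fun n : ℕ => κ.comap (fun hh : (i : ↥(Finset.Iic n)) → S => hh ⟨n, Finset.mem_Iic.2 le_rfl⟩)
          (measurable_pi_apply _)))
        {x : ι → ℕ → S | |(∑ r, ∑ t ∈ range n, f (x r t)) / ((Fintype.card ι : ℝ) * n) - ∫ z, f z ∂π|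
          ≤ z * Real.sqrt (((∑ r, (Scoring.lagSum (fun i => f (x r i)
              - (∑ r', ∑ i ∈ range n, f (x r' i)) / ((Fintype.card ι : ℝ) * n)) n 0 / ((n - 0 : ℕ) : ℝ)
            + 2 * ∑ t ∈ range (W n), Scoring.lagSum (fun i => f (x r i)
              - (∑ r', ∑ i ∈ range n, f (x r' i)) / ((Fintype.card ι : ℝ) * n)) n (t + 1)
                / ((n - (t + 1) : ℕ) : ℝ))) / Fintype.card ι) / ((Fintype.card ι : ℝ) * n))})
      atTop (𝓝 (gaussianReal 0 1 (Icc (-z) z))) := by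
  set c := ∫ z, f z ∂π with hc
  set σ2 := Scoring.autocov κ π (fun y => f y - c) 0
    + 2 * ∑' t, Scoring.autocov κ π (fun y => f y - c) (t + 1) with hσ2
  have hR : 0 < (Fintype.card ι : ℝ) := by exact_mod_cast Fintype.card_pos
  have hE := tendsto_measure_studentized_pooledSum_le_wolff_of_nHit hπ hε hmin hm hf hC hσ hW hW3 μ hz
  have hcons := pooledCentredWindow_tendstoInMeasure_of_nHit hπ hε hmin hm hf hC hW hW3 μ
  set P := Measure.pi fun r => Kernel.trajMeasure (X := fun _ : ℕ => S) (μ r)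
    (fun n : ℕ => κ.comap (fun hh : (i : ↥(Finset.Iic n)) → S => hh ⟨n, Finset.mem_Iic.2 le_rfl⟩)
      (measurable_pi_apply _)) with hP
  set V : ℕ → (ι → ℕ → S) → ℝ := fun n x => (∑ r, (Scoring.lagSum (fun i => f (x r i)
        - (∑ r', ∑ i ∈ range n, f (x r' i)) / ((Fintype.card ι : ℝ) * n)) n 0 / ((n - 0 : ℕ) : ℝ)
      + 2 * ∑ t ∈ range (W n), Scoring.lagSum (fun i => f (x r i)
        - (∑ r', ∑ i ∈ range n, f (x r' i)) / ((Fintype.card ι : ℝ) * n)) n (t + 1)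
          / ((n - (t + 1) : ℕ) : ℝ))) / Fintype.card ι with hV
  set B : ℕ → Set (ι → ℕ → S) := fun n => {x | V n x ≤ 0} ∪ {x | n = 0} with hBdef
  have hBt : Tendsto (fun n => P (B n)) atTop (𝓝 0) := by
    have h1 : Tendsto (fun n => P {x | V n x ≤ 0}) atTop (𝓝 0) := by
      have h := hcons (ENNReal.ofReal σ2) (by simpa using hσ)
      refine tendsto_of_tendsto_of_tendsto_of_le_of_le tendsto_const_nhds h (fun n => bot_le)
        fun n => measure_mono fun x hx => ?_
      simp only [Set.mem_setOf_eq] at hx ⊢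
      rw [edist_dist, Real.dist_eq, abs_sub_comm]
      refine ENNReal.ofReal_le_ofReal ?_
      have hx' : V n x ≤ 0 := hx
      linarith [le_abs_self (σ2 - V n x)]
    have h2 : Tendsto (fun n : ℕ => P {x : ι → ℕ → S | n = 0}) atTop (𝓝 0) := by
      refine tendsto_const_nhds.congr' ?_
      filter_upwards [Filter.eventually_gt_atTop 0] with n hn
      rw [show {x : ι → ℕ → S | n = 0} = ∅ from Set.eq_empty_of_forall_notMem fun x hx => hn.ne' hx,
        measure_empty]
    have h := h1.add h2
    rw [add_zero] at h
    exact tendsto_of_tendsto_of_tendsto_of_le_of_le tendsto_const_nhds h (fun n => bot_le)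
      fun n => measure_union_le _ _
  refine tendsto_measure_of_eq_off_vanishing hBt (fun n => ?_) hE
  have hcast : ∀ n : ℕ, ((Fintype.card ι * n : ℕ) : ℝ) = (Fintype.card ι : ℝ) * n := fun n => by
    push_cast; ring
  ext x
  simp only [hBdef, hV, Set.mem_inter_iff, Set.mem_compl_iff, Set.mem_union, Set.mem_setOf_eq, not_or,
    not_le]
  constructor
  · rintro ⟨h, hVpos, hn⟩
    refine ⟨?_, hVpos, hn⟩
    have hN0 : 0 < Fintype.card ι * n := Nat.mul_pos Fintype.card_pos (Nat.pos_of_ne_zero hn)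
    have key := (abs_studentized_le_iff hN0 (S := ∑ r, ∑ t ∈ range n, (f (x r t) - c)) (z := z)
      hVpos).1
    rw [hcast n] at key
    have hsum : (∑ r, ∑ t ∈ range n, (f (x r t) - c)) / ((Fintype.card ι : ℝ) * n)
        = (∑ r, ∑ t ∈ range n, f (x r t)) / ((Fintype.card ι : ℝ) * n) - c := by
      simp only [Finset.sum_sub_distrib, Finset.sum_const, Finset.card_range, Finset.card_univ,
        nsmul_eq_mul]
      have hn' : (n : ℝ) ≠ 0 := by exact_mod_cast hn
      field_simp
    rw [hsum] at key
    exact key (by simpa only [mul_assoc] using h)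
  · rintro ⟨h, hVpos, hn⟩
    refine ⟨?_, hVpos, hn⟩
    have hN0 : 0 < Fintype.card ι * n := Nat.mul_pos Fintype.card_pos (Nat.pos_of_ne_zero hn)
    have key := (abs_studentized_le_iff hN0 (S := ∑ r, ∑ t ∈ range n, (f (x r t) - c)) (z := z)
      hVpos).2
    rw [hcast n] at key
    have hsum : (∑ r, ∑ t ∈ range n, (f (x r t) - c)) / ((Fintype.card ι : ℝ) * n)
        = (∑ r, ∑ t ∈ range n, f (x r t)) / ((Fintype.card ι : ℝ) * n) - c := by
      simp only [Finset.sum_sub_distrib, Finset.sum_const, Finset.card_range, Finset.card_univ,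
        nsmul_eq_mul]
      have hn' : (n : ℝ) ≠ 0 := by exact_mod_cast hn
      field_simp
    rw [hsum] at key
    simpa only [mul_assoc] using key h

end Pooled

end Summit.Ventures.LatticeQCDFlow.Exactness.GeneralNCMC
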